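/- Copyright: the b2b-balaban cell (near-miss cell 7), T⁴-continuum fan-out; row NE7b OWNER lineage t4-ne7b-p1 (gen 48) —
RULING R-OWNER-48-1 «THE GUARDED CUT», file L3a (the owner's own file of the cut; `CLAIMS.log` l.32451, `HOME/INBOX.md`
l.10673).  Released under the licence of the surrounding project. -/
import Summits.QuantumFields.BalabanUV.T4Continuum.Support.HistoryRealiseCellsRunApexT3bWTVS
import Summits.QuantumFields.BalabanUV.T4Continuum.Support.HistoryRealiseDistinctGuarded

/-!
# Realised histories: THE WEIGHTED `κ := costT` COUNT-ROAD WITNESS WITH THE LABEL-GUARDED JOIN DISPLAY (R-OWNER-48-1, L3a)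

Summits-side support leaf of the T⁴-continuum cell (rung (B)+1 on a FINITE torus only; NOT infinite volume, NOT the mass
gap, NOT the Clay statement; NOT a proof of the spine estimate NE7b, which is the cell's OWN estimate, NOT PRINTED and NOT
PROVED).  [folklore] structure twinning by name over leaf-02's VS-witness `HistoryRealiseCellsRunApexT3bWTVS`
(`CountRoadWitnessT3bWTVS`, `reslack`) and leaf-02's guarded display `HistoryRealiseDistinctGuarded.DisjointJoinsL`
(p278855); one `structure` (a hypothesis SHAPE — data + displayed binders, NOTHING asserted), one `def` (the embedding
`CountRoadWitnessT3bWTVS.toL`), no `[cite:]` tag, nothing printed asserted, no `Prop` fact minted, zero `sorry`.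
Append-only: every landed witness ∕ headline ∕ assembly module stays, UNCHANGED BY NAME.

WHY (R-OWNER-47-3 ∕ R-OWNER-48-1).  The S1c-opt reading clause `disjointJoins` of the W∕WT∕WTV∕WTVS witnesses asks the
UNGUARDED display `HistoryRealiseDistinct.DisjointJoins` («at every join the two partners' constituent regions are pairwise
disjoint»).  On the pass-V reading of print's process (`pedMV`) a component joined with a region containing the image of one
of its own constituents violates it — the display is UNSATISFIABLE AS TYPED (kernel witness
`HistoryRealiseDistinctGuarded.Sanity.not_disjointJoins_nestedToy`), so a witness record carrying it cannot be INHABITED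
from the (α) assembly's reading, and the gate's append-only rule forbids re-defining it in place.  The count never needed
more than the LABEL-GUARDED form `DisjointJoinsL` («partners' births OF EQUAL LABEL have disjoint regions») — the END reads
the clause only through `nodup_map_pbirths` under equal label —, and that form is PROVED for the pass-V process from the
input displays alone (`HistoryGenealogyJunctionVDistinct.InputFamily.disjointJoinsL_pedV`, p281208).  This file is the
witness-level piece of the cut: the VS-witness with the ONE field retyped.

WHAT.  §1 **`structure CountRoadWitnessT3bWTVSL D C O θᵥ …`** = `CountRoadWitnessT3bWTVS` FIELD FOR FIELD, the field
`disjointJoins` retyped to `∀ K, K₀ ≤ K → ∀ τ ∈ T K, ∀ c ∈ liveC K τ, DisjointJoinsL ((ped K τ).toPGen (cellP K τ) c)`.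
§2 **`CountRoadWitnessT3bWTVS.toL`** — every landed VS-witness is an L-witness (`disjointJoinsL_of_disjointJoins`), with
`toL_data`; `nonempty_countRoadWitnessT3bWTVSL_of`; the structure-free string bridge
**`stringHybridNE7_of_hybridNE7T3bWTVSL`** (= `HistoryRealiseCellsRunApexT3b.stringHybridNE7_of_hybridNE7_repr` on the
witness's `reprA`∕`reprB`), for the headline file L3b.

BY-NAME EFFECT.  None on any landed statement.  With L1∕L2 (leaf-02), L3b (leaf-04) and L4∕L5 (custodian) the (α)
assembly's terminal theorem is re-homed on an INHABITABLE record; `WALL-NE7b-P1.md` v1.22 §2: row `disjointJoins` =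
MISSTATED-AS-TYPED ∕ deprecated in place, guarded twin K on pass V; row `boxedBirths` = K modulo the input display
`RegionsInBox`.  HONEST: NE7b NOT proved; spine 0∕9.  HONEST DEPENDENCY (cell): continuum YM on T⁴ ⇐ BetaPertH ∧ nine
spine estimates (0/9 proved); BetaPertH ⇐ (D1) ∧ (D4) ∧ CAP+tail; G-an2-4 gates asym, D1 and NE2/3/4.  Unchanged here. -/

open Finset MeasureTheory
open Literature.MathematicalPhysics.QuantumFieldTheory.Balaban1983to89
open T4PersistenceDictionary T4PersistentHistoryCount T4BankedInduction T4PrintedShapeBanking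
open T4WeightBudget T4GlobalDenominator T4LiveClassFibration T4LiveStructureGas T4LiveGasToTerms T4RecordPriceSeam
open T4PartnerMultiplicity T4IndicatorShell T4MatchingAssembly T4MatchingClosure T4MatchingClosureSocket T4Continuum
open T4StabilitySocket T4BranchingRecordsGas T4TaggedShapeBanking T4CanonicalMenus T4RenewalChains
open Summit.QuantumFields.BalabanUV.T4Continuum.PlacementBatch Summit.QuantumFields.BalabanUV.T4Continuum.PlacementSkeleton
open Summit.QuantumFields.BalabanUV.T4Continuum.CountThresholdUniform Summit.QuantumFields.BalabanUV.T4Continuum.CountThresholdExit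
open Summit.QuantumFields.BalabanUV.T4Continuum.CountSeamJunction Summit.QuantumFields.BalabanUV.T4Continuum.LateMergers
open Summit.QuantumFields.BalabanUV.T4Continuum.HistoryFlow Summit.QuantumFields.BalabanUV.T4Continuum.HistoryRegeneration
open Summit.QuantumFields.BalabanUV.T4Continuum.HistoryTables Summit.QuantumFields.BalabanUV.T4Continuum.HistoryAssemblyTrees
open Summit.QuantumFields.BalabanUV.T4Continuum.HistoryAssemblyTerms Summit.QuantumFields.BalabanUV.T4Continuum.HistoryAssemblyPedigree
open Summit.QuantumFields.BalabanUV.T4Continuum.HistoryConstants Summit.QuantumFields.BalabanUV.T4Continuum.HistoryGen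
open Literature.MathematicalPhysics.QuantumFieldTheory.Balaban1983to89.B13ScaleTransfer
open Summit.QuantumFields.BalabanUV.T4Continuum.ZoneSkeleton Summit.QuantumFields.BalabanUV.T4Continuum.HistorySocketTH
open Summit.QuantumFields.BalabanUV.T4Continuum.HistoryCaps Summit.QuantumFields.BalabanUV.T4Continuum.HistoryAssemblyPrice
open Summit.QuantumFields.BalabanUV.T4Continuum.HistoryBankingLE Summit.QuantumFields.BalabanUV.T4Continuum.HistoryExitLE
open Summit.QuantumFields.BalabanUV.T4Continuum.HistoryAssemblyTreesLE Summit.QuantumFields.BalabanUV.T4Continuum.HistoryAssemblyTermsLE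
open Summit.QuantumFields.BalabanUV.T4Continuum.HistoryRealise Summit.QuantumFields.BalabanUV.T4Continuum.HistoryAssemblyRealiseLE
open Summit.QuantumFields.BalabanUV.T4Continuum.HistoryAssemblyMult Summit.QuantumFields.BalabanUV.T4Continuum.HistoryAssemblyMultKey
open Summit.QuantumFields.BalabanUV.T4Continuum.HistoryAssemblyRealiseRun Summit.QuantumFields.BalabanUV.T4Continuum.HistoryAssemblyRealiseMult
open Summit.QuantumFields.BalabanUV.T4Continuum.HistoryZones Summit.QuantumFields.BalabanUV.T4Continuum.HistoryRealiseCells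
open Summit.QuantumFields.BalabanUV.T4Continuum.HistoryRealiseCellsRun Summit.QuantumFields.BalabanUV.T4Continuum.HistoryAssemblyRealiseRunMult
open Summit.QuantumFields.BalabanUV.T4Continuum.HistoryRealiseCellsRunMult Summit.QuantumFields.BalabanUV.T4Continuum.HistoryAssemblyMultInstance
open Summit.QuantumFields.BalabanUV.T4Continuum.HistoryJoinsPlacedMember Summit.QuantumFields.BalabanUV.T4Continuum.PlacementSkeleton
open Summit.QuantumFields.BalabanUV.T4Continuum.HistoryJoinsPlacedMult Summit.QuantumFields.BalabanUV.T4Continuum.HistoryRealiseDistinct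
open Summit.QuantumFields.BalabanUV.T4Continuum.HistoryRegionTemplates Summit.QuantumFields.BalabanUV.T4Continuum.HistoryCaps
open Summit.QuantumFields.BalabanUV.T4Continuum.HistoryZoneEvolve (cth)
open Literature.MathematicalPhysics.QuantumFieldTheory.Balaban1983to89.B16SProfile (DropCtl)
open Summit.QuantumFields.BalabanUV.T4Continuum.HistoryRealiseCellsRunMultEnd Summit.QuantumFields.BalabanUV.T4Continuum.HistoryRealiseCellsRunMultEndD
open Summit.QuantumFields.BalabanUV.T4Continuum.HistoryRealiseCellsRunPinnedT3b Summit.QuantumFields.BalabanUV.T4Continuum.HistoryHybridRescale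
open Summit.QuantumFields.BalabanUV.T4Continuum.HistoryRealiseCellsRunApex (exists_const_schemeZ)
open Summit.QuantumFields.BalabanUV.T4Continuum.HistoryRealisePrint Summit.QuantumFields.BalabanUV.T4Continuum.HistoryRealiseWeak
open Summit.QuantumFields.BalabanUV.T4Continuum.HistoryRealisePrintReading Summit.QuantumFields.BalabanUV.T4Continuum.HistoryRealiseWeakReading
open Summit.QuantumFields.BalabanUV.T4Continuum.HistoryRealisePrintCells Summit.QuantumFields.BalabanUV.T4Continuum.HistoryRealiseWeakCells
open Summit.QuantumFields.BalabanUV.T4Continuum.HistoryRealiseCellsRunApexT3b Summit.QuantumFields.BalabanUV.T4Continuum.HistoryRealiseCellsRunApexT3bW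

open Summit.QuantumFields.BalabanUV.T4Continuum.HistoryRealiseCellsRunApexT3bWT Summit.QuantumFields.BalabanUV.T4Continuum.HistoryRealiseCellsRunPinnedT3bWT
open Summit.QuantumFields.BalabanUV.T4Continuum.HistoryRealiseCellsRunHeadlineT3bWT
open Summit.QuantumFields.BalabanUV.T4Continuum.HistoryRealiseCellsRunApexT3bWTV Summit.QuantumFields.BalabanUV.T4Continuum.HistoryBankingVolumePlug
open Summit.QuantumFields.BalabanUV.T4Continuum.HistoryRealiseCellsRunApexT3bWTVS
open Summit.QuantumFields.BalabanUV.T4Continuum.HistoryRealiseDistinctGuarded (DisjointJoinsL disjointJoinsL_of_disjointJoins)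

namespace Summit.QuantumFields.BalabanUV.T4Continuum.HistoryRealiseCellsRunApexT3bWTVSL

noncomputable section

section Apex

variable {F : T4Family} {G : Type*} [GaugeGroup G] [MeasurableSpace G] [HaarData G] [RegularGaugeGroup G]


/-- **A COUNT-ROAD WITNESS OVER END v3′, MEMORY-AGNOSTIC CARRIER, `κ := costT`, WEIGHTED CLASS REMAINDER DISPLAYED,
LABEL-GUARDED JOIN DISPLAY** (HYPOTHESIS SHAPE — data + END v3′'s displayed binders, NOTHING asserted): leaf-02's
`CountRoadWitnessT3bWTVS` FIELD FOR FIELD, with the ONE reading clause `disjointJoins` retyped from the unguarded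
`DisjointJoins` (unsatisfiable as typed on the pass-V process) to the label-guarded `DisjointJoinsL` — the form the count
reads and the form the (α) assembly PROVES of its reading (`InputFamily.disjointJoinsL_pedV`).  Every other field is
TOKEN FOR TOKEN (R-OWNER-48-1, L3a). [folklore] -/
structure CountRoadWitnessT3bWTVSL (D : FiniteEpsData F G) (C : T4PrintedShapeBanking.Consts) (O : PrintedO1s) (θv : ℝ)
    (rr d n : ℕ) (hn : 0 < n) (g₀ : ℕ → ℝ) (os : List (ULoop F)) (ι α π : Type) [DecidableEq ι] [DecidableEq α]
    [DecidableEq π] : Type where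
  /-- the source radius -/
  l₀ : ℝ
  /-- the volume factor of the matching remainders -/
  vol : ℝ
  /-- the source radius is positive -/
  l₀_pos : 0 < l₀
  /-- the volume factor is positive -/
  vol_pos : 0 < vol
  /-- the threshold in the number of steps -/
  K₀ : ℕ
  /-- the term families -/
  T : ℕ → Finset ι
  /-- run A's term weights (`K` steps) -/
  A : ℕ → ℝ → ι → ℝ
  /-- run B's term weights (`K + 1` steps) -/
  A' : ℕ → ℝ → ι → ℝ
  /-- the two runs' shell parts (NE7c) -/
  (shA shB : ℕ → ℝ → ι → ℝ)
  /-- the two runs' dead weights (numerator reading) -/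
  (dead dead' : ℕ → ℝ → ι → ℝ)
  /-- the two runs' upper normalisation envelopes -/
  (nup mup : ℕ → ℝ → ℝ)
  /-- the common envelope bound -/
  Nup : ℝ
  /-- NE7 core budget data (`ReindexedBudget`) -/
  (Cc Rr CcRec RrRec : ℕ → ℝ → ι → ℝ)
  /-- NE7 core budget rates; `u s₂ r s` summable -/
  (ν u s₂ q₀ r s : ℕ → ℝ)
  /-- NE7c's shell weight budget -/
  Wsh : ℕ → ℝ
  /-- E1 REPRESENTATION (Bałaban's normalisation): run A's terms sum to the dressed integral of `ρ₀` after `K` steps -/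
  reprA : ∀ K t, |t| ≤ l₀ → K₀ ≤ K →
    ∫ U, Real.exp (t * T4GenFunBounds.prodObs (D.scheme g₀) K os U) * D.dens K (g₀ K) 0 U ∂fieldMeasure (F.P K) 0 G =
      ∑ τ ∈ T K, A K t τ
  /-- E2 REPRESENTATION: run B's terms sum to the dressed integral of `ρ₀` after `K + 1` steps -/
  reprB : ∀ K t, |t| ≤ l₀ → K₀ ≤ K →
    ∫ U, Real.exp (t * T4GenFunBounds.prodObs (D.scheme g₀) (K + 1) os U) * D.dens (K + 1) (g₀ (K + 1)) 0 U
        ∂fieldMeasure (F.P (K + 1)) 0 G = ∑ τ ∈ T K, A' K t τ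
  /-- the (γ) small-field mass floor -/
  c₀ : ℝ
  /-- the site budget -/
  n₁ : ℝ
  /-- the floor is positive -/
  c₀_pos : 0 < c₀
  /-- (γ) floor, run A -/
  floor : ∀ K, K₀ ≤ K → c₀ ≤ smallFieldMass D K (g₀ K)
  /-- (γ) floor, run B -/
  floor' : ∀ K, K₀ ≤ K → c₀ ≤ smallFieldMass D (K + 1) (g₀ (K + 1))
  /-- site budget, run A -/
  sites : ∀ K, K₀ ≤ K → ((D.C ⟨K, F.m, g₀ K⟩).numSites K : ℝ) ≤ n₁
  /-- site budget, run B -/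
  sites' : ∀ K, K₀ ≤ K → ((D.C ⟨K + 1, F.m, g₀ (K + 1)⟩).numSites (K + 1) : ℝ) ≤ n₁
  /-- the envelope bound is nonnegative -/
  Nup_nonneg : 0 ≤ Nup
  /-- envelope, run A -/
  nup_bd : ∀ K t, |t| ≤ l₀ → K₀ ≤ K → 0 ≤ nup K t ∧ nup K t ≤ Nup
  /-- envelope, run B -/
  mup_bd : ∀ K t, |t| ≤ l₀ → K₀ ≤ K → 0 ≤ mup K t ∧ mup K t ≤ Nup
  /-- the size function of (2.5) -/
  R : ℕ → ℕ → ℕ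
  /-- (2.5): `R K s` is an admissible size for the running coupling at step `s` -/
  isRj : ∀ K s, s ≤ K → B14.IsRj F.L rr ((D.C ⟨K, F.m, g₀ K⟩).flow.g s) (R K s)
  /-- sizes are at least one -/
  one_le_R : ∀ K, K₀ ≤ K → ∀ t, 1 ≤ R K t
  /-- H3: the reading map, pedigrees -/
  ped : ℕ → ι → Pedigree α π
  /-- H3: the reading map, root data of the live components -/
  cellP : ℕ → ι → π → Pt d × Finset (Pt d)
  /-- H3: the reading map, live components of each term -/
  liveC : ℕ → ι → Finset α
  /-- H3: the reading map, domains -/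
  Zd : ℕ → ι → α → Finset (Pt d)
  /-- H3: the pedigrees are WEAKLY (memory-agnostically) REALISED by the run's own profile with their domains:
  `real := RealisesW … ∧ PendingBefore … K` (leaf-03's IR-41-4 (3) carrier over the owner's core `RealisesW`) -/
  realised : RealisedDomainsRW F.L (runProfile F.L R) n K₀ R T ped cellP liveC Zd
  /-- H3: live components are dated no later than the cutoff -/
  step_le : ∀ K, K₀ ≤ K → ∀ τ ∈ T K, ∀ c ∈ liveC K τ, (ped K τ).step c ≤ K
  /-- H3 (row S1c-opt reading clause, LABEL-GUARDED form of R-OWNER-47-3 ∕ 48-1): at every join of a live component's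
  member, partners' births OF EQUAL LABEL have disjoint regions -/
  disjointJoins : ∀ K, K₀ ≤ K → ∀ τ ∈ T K, ∀ c ∈ liveC K τ, DisjointJoinsL ((ped K τ).toPGen (cellP K τ) c)
  /-- H3 (row S1c-opt reading clause): constituents inside the torus' fundamental box at their birth levels -/
  boxedBirths : ∀ K, K₀ ≤ K → ∀ τ ∈ T K, ∀ c ∈ liveC K τ,
    BoxedBirths n F.L K (levelOf (runProfile F.L R K) K) ((ped K τ).toPGen (cellP K τ) c)
  /-- H3: live price ∕ dead-part resummation factors of the PHYSICAL member families, both runs -/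
  (FcM RfM FcM' RfM' : ℕ → Finset ((Fin d → ℕ) × Gen PEv × Multiset (PEv × ((Fin d → ℕ) × Finset (Pt d)))) → ℝ)
  /-- M5-2c: the displayed WEIGHT FAMILY of the volume remainder (per cutoff and birth step; the plug's `2^{d+3}·log Λ K j`) -/
  uV : ℕ → ℕ → ℝ
  /-- M5-2c, display D-V1 at the priced members' births: `uV K j ≤ θᵥ·p₀(g_j)²` (item (1)'s socket form `huV`) -/
  huV : ∀ K, K₀ ≤ K → ∀ τ ∈ badTerms (memOf ped liveC (cellOfR n F.L (runProfile F.L R) ped cellP)) jhalf T K,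
    ∀ q ∈ memOf ped liveC (cellOfR n F.L (runProfile F.L R) ped cellP) K τ, ∀ e ∈ q.2.events, (Prod.fst e).kind = 0 →
      uV K (Prod.fst e).step ≤ θv * p0Profile C.A₀ C.p₀ ((D.C ⟨K, F.m, g₀ K⟩).flow.g (Prod.fst e).step) ^ 2
  /-- H3: the per-term price sentence in print's currency at `κ := costT` WITH the weighted class remainder `exp (birthWT Prod.fst (uV K) q.2)` and the displayed discount `exp(−Ξ)`, run A -/
  priceM : ∀ K t, |t| ≤ l₀ → K₀ ≤ K → ∀ τ ∈ badTerms (memOf ped liveC (cellOfR n F.L (runProfile F.L R) ped cellP)) jhalf T K,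
    FcM K (kmemOf ped liveC (cellOfR n F.L (runProfile F.L R) ped cellP) (physV n F.L hn (Nat.lt_of_lt_of_le Nat.zero_lt_two (two_le_L F))
    (fun K => tcap d (dcapOf Prod.fst T (memOf ped liveC (cellOfR n F.L (runProfile F.L R) ped cellP)) K))
    (fun K => one_le_tcap d (dcapOf Prod.fst T (memOf ped liveC (cellOfR n F.L (runProfile F.L R) ped cellP)) K)) (runProfile F.L R) ped cellP) K τ) * RfM K (kmemOf ped liveC (cellOfR n F.L (runProfile F.L R) ped cellP) (physV n F.L hn (Nat.lt_of_lt_of_le Nat.zero_lt_two (two_le_L F))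
    (fun K => tcap d (dcapOf Prod.fst T (memOf ped liveC (cellOfR n F.L (runProfile F.L R) ped cellP)) K))
    (fun K => one_le_tcap d (dcapOf Prod.fst T (memOf ped liveC (cellOfR n F.L (runProfile F.L R) ped cellP)) K)) (runProfile F.L R) ped cellP) K τ) ≤
    ∏ q ∈ memOf ped liveC (cellOfR n F.L (runProfile F.L R) ped cellP) K τ,
    pshapeTH Prod.fst O C 1 1 (R K) (D.C ⟨K, F.m, g₀ K⟩).flow.g 0 (costT Prod.fst C K (R K)) q.2 * Real.exp (birthWT Prod.fst (uV K) q.2) *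
      Real.exp (-(8 / C.E₂ * totalCostT Prod.fst C K (R K) q.2 + 4 * (partnerAges (PEv.step ∘ Prod.fst) q.2 : ℝ)))
  /-- H3: the per-term price sentence at `κ := costT` WITH the weighted class remainder and the displayed discount, run B -/
  priceM' : ∀ K t, |t| ≤ l₀ → K₀ ≤ K → ∀ τ ∈ badTerms (memOf ped liveC (cellOfR n F.L (runProfile F.L R) ped cellP)) jhalf T K,
    FcM' K (kmemOf ped liveC (cellOfR n F.L (runProfile F.L R) ped cellP) (physV n F.L hn (Nat.lt_of_lt_of_le Nat.zero_lt_two (two_le_L F))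
    (fun K => tcap d (dcapOf Prod.fst T (memOf ped liveC (cellOfR n F.L (runProfile F.L R) ped cellP)) K))
    (fun K => one_le_tcap d (dcapOf Prod.fst T (memOf ped liveC (cellOfR n F.L (runProfile F.L R) ped cellP)) K)) (runProfile F.L R) ped cellP) K τ) * RfM' K (kmemOf ped liveC (cellOfR n F.L (runProfile F.L R) ped cellP) (physV n F.L hn (Nat.lt_of_lt_of_le Nat.zero_lt_two (two_le_L F))
    (fun K => tcap d (dcapOf Prod.fst T (memOf ped liveC (cellOfR n F.L (runProfile F.L R) ped cellP)) K))
    (fun K => one_le_tcap d (dcapOf Prod.fst T (memOf ped liveC (cellOfR n F.L (runProfile F.L R) ped cellP)) K)) (runProfile F.L R) ped cellP) K τ) ≤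
    ∏ q ∈ memOf ped liveC (cellOfR n F.L (runProfile F.L R) ped cellP) K τ,
    pshapeTH Prod.fst O C 1 1 (R K) (D.C ⟨K, F.m, g₀ K⟩).flow.g 0 (costT Prod.fst C K (R K)) q.2 * Real.exp (birthWT Prod.fst (uV K) q.2) *
      Real.exp (-(8 / C.E₂ * totalCostT Prod.fst C K (R K) q.2 + 4 * (partnerAges (PEv.step ∘ Prod.fst) q.2 : ℝ)))
  /-- H3 numerator reading, run A: terms below dead weight × live price of the physical member family × envelope -/
  upM : ∀ K t, |t| ≤ l₀ → K₀ ≤ K →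
    ∀ k ∈ badGMems (memOf ped liveC (cellOfR n F.L (runProfile F.L R) ped cellP)) jhalf T (kmemOf ped liveC (cellOfR n F.L (runProfile F.L R) ped cellP) (physV n F.L hn (Nat.lt_of_lt_of_le Nat.zero_lt_two (two_le_L F))
    (fun K => tcap d (dcapOf Prod.fst T (memOf ped liveC (cellOfR n F.L (runProfile F.L R) ped cellP)) K))
    (fun K => one_le_tcap d (dcapOf Prod.fst T (memOf ped liveC (cellOfR n F.L (runProfile F.L R) ped cellP)) K)) (runProfile F.L R) ped cellP)) K,
    ∀ τ ∈ fibre (kmemOf ped liveC (cellOfR n F.L (runProfile F.L R) ped cellP) (physV n F.L hn (Nat.lt_of_lt_of_le Nat.zero_lt_two (two_le_L F))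
    (fun K => tcap d (dcapOf Prod.fst T (memOf ped liveC (cellOfR n F.L (runProfile F.L R) ped cellP)) K))
    (fun K => one_le_tcap d (dcapOf Prod.fst T (memOf ped liveC (cellOfR n F.L (runProfile F.L R) ped cellP)) K)) (runProfile F.L R) ped cellP)) T K k, A K t τ ≤ dead K t τ * FcM K k * nup K t
  /-- H3 numerator reading, run A: dead weights nonnegative -/
  deadM_nonneg : ∀ K t, |t| ≤ l₀ → K₀ ≤ K →
    ∀ k ∈ badGMems (memOf ped liveC (cellOfR n F.L (runProfile F.L R) ped cellP)) jhalf T (kmemOf ped liveC (cellOfR n F.L (runProfile F.L R) ped cellP) (physV n F.L hn (Nat.lt_of_lt_of_le Nat.zero_lt_two (two_le_L F))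
    (fun K => tcap d (dcapOf Prod.fst T (memOf ped liveC (cellOfR n F.L (runProfile F.L R) ped cellP)) K))
    (fun K => one_le_tcap d (dcapOf Prod.fst T (memOf ped liveC (cellOfR n F.L (runProfile F.L R) ped cellP)) K)) (runProfile F.L R) ped cellP)) K,
    ∀ τ ∈ fibre (kmemOf ped liveC (cellOfR n F.L (runProfile F.L R) ped cellP) (physV n F.L hn (Nat.lt_of_lt_of_le Nat.zero_lt_two (two_le_L F))
    (fun K => tcap d (dcapOf Prod.fst T (memOf ped liveC (cellOfR n F.L (runProfile F.L R) ped cellP)) K))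
    (fun K => one_le_tcap d (dcapOf Prod.fst T (memOf ped liveC (cellOfR n F.L (runProfile F.L R) ped cellP)) K)) (runProfile F.L R) ped cellP)) T K k, 0 ≤ dead K t τ
  /-- H3 numerator reading, run A: the dead-part resummation over terms with EQUAL physical live data -/
  resumM : ∀ K t, |t| ≤ l₀ → K₀ ≤ K →
    ∀ k ∈ badGMems (memOf ped liveC (cellOfR n F.L (runProfile F.L R) ped cellP)) jhalf T (kmemOf ped liveC (cellOfR n F.L (runProfile F.L R) ped cellP) (physV n F.L hn (Nat.lt_of_lt_of_le Nat.zero_lt_two (two_le_L F))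
    (fun K => tcap d (dcapOf Prod.fst T (memOf ped liveC (cellOfR n F.L (runProfile F.L R) ped cellP)) K))
    (fun K => one_le_tcap d (dcapOf Prod.fst T (memOf ped liveC (cellOfR n F.L (runProfile F.L R) ped cellP)) K)) (runProfile F.L R) ped cellP)) K,
    ∑ τ ∈ fibre (kmemOf ped liveC (cellOfR n F.L (runProfile F.L R) ped cellP) (physV n F.L hn (Nat.lt_of_lt_of_le Nat.zero_lt_two (two_le_L F))
    (fun K => tcap d (dcapOf Prod.fst T (memOf ped liveC (cellOfR n F.L (runProfile F.L R) ped cellP)) K))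
    (fun K => one_le_tcap d (dcapOf Prod.fst T (memOf ped liveC (cellOfR n F.L (runProfile F.L R) ped cellP)) K)) (runProfile F.L R) ped cellP)) T K k, dead K t τ ≤ RfM K k
  /-- H3 numerator reading, run A: live prices nonnegative -/
  FM_nonneg : ∀ K t, |t| ≤ l₀ → K₀ ≤ K →
    ∀ k ∈ badGMems (memOf ped liveC (cellOfR n F.L (runProfile F.L R) ped cellP)) jhalf T (kmemOf ped liveC (cellOfR n F.L (runProfile F.L R) ped cellP) (physV n F.L hn (Nat.lt_of_lt_of_le Nat.zero_lt_two (two_le_L F))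
    (fun K => tcap d (dcapOf Prod.fst T (memOf ped liveC (cellOfR n F.L (runProfile F.L R) ped cellP)) K))
    (fun K => one_le_tcap d (dcapOf Prod.fst T (memOf ped liveC (cellOfR n F.L (runProfile F.L R) ped cellP)) K)) (runProfile F.L R) ped cellP)) K, 0 ≤ FcM K k
  /-- H3 numerator reading, run B -/
  upM' : ∀ K t, |t| ≤ l₀ → K₀ ≤ K →
    ∀ k ∈ badGMems (memOf ped liveC (cellOfR n F.L (runProfile F.L R) ped cellP)) jhalf T (kmemOf ped liveC (cellOfR n F.L (runProfile F.L R) ped cellP) (physV n F.L hn (Nat.lt_of_lt_of_le Nat.zero_lt_two (two_le_L F))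
    (fun K => tcap d (dcapOf Prod.fst T (memOf ped liveC (cellOfR n F.L (runProfile F.L R) ped cellP)) K))
    (fun K => one_le_tcap d (dcapOf Prod.fst T (memOf ped liveC (cellOfR n F.L (runProfile F.L R) ped cellP)) K)) (runProfile F.L R) ped cellP)) K,
    ∀ τ ∈ fibre (kmemOf ped liveC (cellOfR n F.L (runProfile F.L R) ped cellP) (physV n F.L hn (Nat.lt_of_lt_of_le Nat.zero_lt_two (two_le_L F))
    (fun K => tcap d (dcapOf Prod.fst T (memOf ped liveC (cellOfR n F.L (runProfile F.L R) ped cellP)) K))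
    (fun K => one_le_tcap d (dcapOf Prod.fst T (memOf ped liveC (cellOfR n F.L (runProfile F.L R) ped cellP)) K)) (runProfile F.L R) ped cellP)) T K k, A' K t τ ≤ dead' K t τ * FcM' K k * mup K t
  /-- H3 numerator reading, run B -/
  deadM'_nonneg : ∀ K t, |t| ≤ l₀ → K₀ ≤ K →
    ∀ k ∈ badGMems (memOf ped liveC (cellOfR n F.L (runProfile F.L R) ped cellP)) jhalf T (kmemOf ped liveC (cellOfR n F.L (runProfile F.L R) ped cellP) (physV n F.L hn (Nat.lt_of_lt_of_le Nat.zero_lt_two (two_le_L F))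
    (fun K => tcap d (dcapOf Prod.fst T (memOf ped liveC (cellOfR n F.L (runProfile F.L R) ped cellP)) K))
    (fun K => one_le_tcap d (dcapOf Prod.fst T (memOf ped liveC (cellOfR n F.L (runProfile F.L R) ped cellP)) K)) (runProfile F.L R) ped cellP)) K,
    ∀ τ ∈ fibre (kmemOf ped liveC (cellOfR n F.L (runProfile F.L R) ped cellP) (physV n F.L hn (Nat.lt_of_lt_of_le Nat.zero_lt_two (two_le_L F))
    (fun K => tcap d (dcapOf Prod.fst T (memOf ped liveC (cellOfR n F.L (runProfile F.L R) ped cellP)) K))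
    (fun K => one_le_tcap d (dcapOf Prod.fst T (memOf ped liveC (cellOfR n F.L (runProfile F.L R) ped cellP)) K)) (runProfile F.L R) ped cellP)) T K k, 0 ≤ dead' K t τ
  /-- H3 numerator reading, run B -/
  resumM' : ∀ K t, |t| ≤ l₀ → K₀ ≤ K →
    ∀ k ∈ badGMems (memOf ped liveC (cellOfR n F.L (runProfile F.L R) ped cellP)) jhalf T (kmemOf ped liveC (cellOfR n F.L (runProfile F.L R) ped cellP) (physV n F.L hn (Nat.lt_of_lt_of_le Nat.zero_lt_two (two_le_L F))
    (fun K => tcap d (dcapOf Prod.fst T (memOf ped liveC (cellOfR n F.L (runProfile F.L R) ped cellP)) K))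
    (fun K => one_le_tcap d (dcapOf Prod.fst T (memOf ped liveC (cellOfR n F.L (runProfile F.L R) ped cellP)) K)) (runProfile F.L R) ped cellP)) K,
    ∑ τ ∈ fibre (kmemOf ped liveC (cellOfR n F.L (runProfile F.L R) ped cellP) (physV n F.L hn (Nat.lt_of_lt_of_le Nat.zero_lt_two (two_le_L F))
    (fun K => tcap d (dcapOf Prod.fst T (memOf ped liveC (cellOfR n F.L (runProfile F.L R) ped cellP)) K))
    (fun K => one_le_tcap d (dcapOf Prod.fst T (memOf ped liveC (cellOfR n F.L (runProfile F.L R) ped cellP)) K)) (runProfile F.L R) ped cellP)) T K k, dead' K t τ ≤ RfM' K k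
  /-- H3 numerator reading, run B -/
  FM'_nonneg : ∀ K t, |t| ≤ l₀ → K₀ ≤ K →
    ∀ k ∈ badGMems (memOf ped liveC (cellOfR n F.L (runProfile F.L R) ped cellP)) jhalf T (kmemOf ped liveC (cellOfR n F.L (runProfile F.L R) ped cellP) (physV n F.L hn (Nat.lt_of_lt_of_le Nat.zero_lt_two (two_le_L F))
    (fun K => tcap d (dcapOf Prod.fst T (memOf ped liveC (cellOfR n F.L (runProfile F.L R) ped cellP)) K))
    (fun K => one_le_tcap d (dcapOf Prod.fst T (memOf ped liveC (cellOfR n F.L (runProfile F.L R) ped cellP)) K)) (runProfile F.L R) ped cellP)) K, 0 ≤ FcM' K k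
  /-- NE7c: the indicator shells' relative weight bound -/
  shell : ShellWeightBound l₀ T A A' shA shB Wsh
  /-- NE7: the core budget on the hybrid cores over the bad classes -/
  budget : ReindexedBudget l₀ vol T (fun K t τ => A K t τ - shA K t τ) (fun K t τ => A' K t τ - shB K t τ)
    (badOfClass (bstrOf Prod.fst (memOf ped liveC (cellOfR n F.L (runProfile F.L R) ped cellP))) T
    (fun K _ => badClasses Prod.fst (memOf ped liveC (cellOfR n F.L (runProfile F.L R) ped cellP)) jhalf T K)) Cc Rr CcRec RrRec ν u s₂ q₀ r s
  /-- summable rates -/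
  sum_r : Summable r
  /-- summable rates -/
  sum_u : Summable u
  /-- summable rates -/
  sum_s : Summable s
  /-- summable rates -/
  sum_s₂ : Summable s₂

/-! ## §2 Every landed VS-witness is an L-witness; the structure-free string bridge -/

omit [RegularGaugeGroup G] in
/-- **THE EMBEDDING**: every field copied, the join display weakened along `disjointJoinsL_of_disjointJoins`.  Hence the
L-headline (file L3b) is at least as strong as the VS-headline of record, BY NAME. [folklore] -/
def _root_.Summit.QuantumFields.BalabanUV.T4Continuum.HistoryRealiseCellsRunApexT3bWTVS.CountRoadWitnessT3bWTVS.toL {D : FiniteEpsData F G} {C : T4PrintedShapeBanking.Consts} {O : PrintedO1s} {θv : ℝ}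
    {rr d n : ℕ} {hn : 0 < n} {g₀ : ℕ → ℝ} {os : List (ULoop F)} {ι α π : Type} [DecidableEq ι] [DecidableEq α]
    [DecidableEq π] (X : CountRoadWitnessT3bWTVS D C O θv rr d n hn g₀ os ι α π) :
    CountRoadWitnessT3bWTVSL D C O θv rr d n hn g₀ os ι α π :=
  { l₀ := X.l₀, vol := X.vol, l₀_pos := X.l₀_pos, vol_pos := X.vol_pos, K₀ := X.K₀, T := X.T, A := X.A, A' := X.A',
    shA := X.shA, shB := X.shB, dead := X.dead, dead' := X.dead', nup := X.nup, mup := X.mup, Nup := X.Nup, Cc :=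
    X.Cc, Rr := X.Rr, CcRec := X.CcRec, RrRec := X.RrRec, ν := X.ν, u := X.u, s₂ := X.s₂, q₀ := X.q₀, r := X.r, s :=
    X.s, Wsh := X.Wsh, reprA := X.reprA, reprB := X.reprB, c₀ := X.c₀, n₁ := X.n₁, c₀_pos := X.c₀_pos, floor :=
    X.floor, floor' := X.floor', sites := X.sites, sites' := X.sites', Nup_nonneg := X.Nup_nonneg, nup_bd :=
    X.nup_bd, mup_bd := X.mup_bd, R := X.R, isRj := X.isRj, one_le_R := X.one_le_R, ped := X.ped, cellP := X.cellP,
    liveC := X.liveC, Zd := X.Zd, realised := X.realised, step_le := X.step_le,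
    disjointJoins := fun K hK τ hτ c hc => disjointJoinsL_of_disjointJoins _ (X.disjointJoins K hK τ hτ c hc),
    boxedBirths := X.boxedBirths,
    FcM := X.FcM, RfM := X.RfM, FcM' := X.FcM', RfM' := X.RfM', uV := X.uV, huV := X.huV, priceM := X.priceM,
    priceM' := X.priceM', upM := X.upM, deadM_nonneg := X.deadM_nonneg, resumM := X.resumM, FM_nonneg := X.FM_nonneg,
    upM' := X.upM', deadM'_nonneg := X.deadM'_nonneg, resumM' := X.resumM', FM'_nonneg := X.FM'_nonneg, shell := X.shell,
    budget := X.budget, sum_r := X.sum_r, sum_u := X.sum_u, sum_s := X.sum_s, sum_s₂ := X.sum_s₂ }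

omit [RegularGaugeGroup G] in
/-- the embedding keeps the data the END reads (terms, weights, sizes, pedigrees, price factors, weight family) [folklore] -/
theorem _root_.Summit.QuantumFields.BalabanUV.T4Continuum.HistoryRealiseCellsRunApexT3bWTVS.CountRoadWitnessT3bWTVS.toL_data {D : FiniteEpsData F G} {C : T4PrintedShapeBanking.Consts} {O : PrintedO1s}
    {θv : ℝ} {rr d n : ℕ} {hn : 0 < n} {g₀ : ℕ → ℝ} {os : List (ULoop F)} {ι α π : Type} [DecidableEq ι]
    [DecidableEq α] [DecidableEq π] (X : CountRoadWitnessT3bWTVS D C O θv rr d n hn g₀ os ι α π) :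
    X.toL.T = X.T ∧ X.toL.A = X.A ∧ X.toL.A' = X.A' ∧ X.toL.R = X.R ∧ X.toL.ped = X.ped ∧
      X.toL.FcM = X.FcM ∧ X.toL.RfM = X.RfM ∧ X.toL.uV = X.uV :=
  ⟨rfl, rfl, rfl, rfl, rfl, rfl, rfl, rfl⟩

omit [RegularGaugeGroup G] in
/-- inhabitation transports along the embedding (so leaf-06's non-vacuity toys for the VS-witness serve the L-witness)
[folklore] -/
theorem nonempty_countRoadWitnessT3bWTVSL_of {D : FiniteEpsData F G} {C : T4PrintedShapeBanking.Consts} {O : PrintedO1s}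
    {θv : ℝ} {rr d n : ℕ} {hn : 0 < n} {g₀ : ℕ → ℝ} {os : List (ULoop F)} {ι α π : Type} [DecidableEq ι]
    [DecidableEq α] [DecidableEq π] (h : Nonempty (CountRoadWitnessT3bWTVS D C O θv rr d n hn g₀ os ι α π)) :
    Nonempty (CountRoadWitnessT3bWTVSL D C O θv rr d n hn g₀ os ι α π) :=
  h.map CountRoadWitnessT3bWTVS.toL

omit [RegularGaugeGroup G] in
/-- **ONE STRING: END ⇒ THE APEX'S PER-STRING HYBRID-NE7 DATUM, read off an L-witness** — the landed, structure-free
`HistoryRealiseCellsRunApexT3b.stringHybridNE7_of_hybridNE7_repr` (BY NAME) with the data and the E1∕E2 identities of a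
`CountRoadWitnessT3bWTVSL` (twin of `HistoryRealiseCellsRunApexT3bWT.stringHybridNE7_of_hybridNE7T3bWT`; no reading field
is read here). [folklore] -/
theorem stringHybridNE7_of_hybridNE7T3bWTVSL (D : FiniteEpsData F G) {C : T4PrintedShapeBanking.Consts} {O : PrintedO1s}
    {θv : ℝ} {rr d n : ℕ} {hn : 0 < n} {g₀ : ℕ → ℝ} {os : List (ULoop F)} {ι α π : Type} [DecidableEq ι] [DecidableEq α]
    [DecidableEq π] (X : CountRoadWitnessT3bWTVSL D C O θv rr d n hn g₀ os ι α π) {Bad : ℕ → ℝ → Finset ι} {W δ : ℕ → ℝ}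
    {K₁ K₂ : ℕ} (hK : X.K₀ ≤ K₁)
    (hH : HybridNE7 X.l₀ X.vol (fun K => X.T (K₁ + (K₂ + K))) (fun K => X.A (K₁ + (K₂ + K)))
      (fun K => X.A' (K₁ + (K₂ + K))) Bad W (fun K => X.shA (K₁ + (K₂ + K))) (fun K => X.shB (K₁ + (K₂ + K)))
      (fun K => X.Wsh (K₁ + (K₂ + K))) δ) :
    StringHybridNE7 (D.scheme g₀) os X.l₀ X.vol (K₁ + K₂) :=
  stringHybridNE7_of_hybridNE7_repr D X.reprA X.reprB hK hH

end Apex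

end

end Summit.QuantumFields.BalabanUV.T4Continuum.HistoryRealiseCellsRunApexT3bWTVSL
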